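import Literature.MathematicalPhysics.QuantumFieldTheory.Balaban1983to89.Node00.LargeFieldTowerShapes

/-!
# NODE 00 — DEFINER ₇b support (typing hand `pub-ymgap-dag-n12-b`, dag-lead [REBALANCE-22] (α), announced
# [DAGN12B-G0-FACTORIZES-DECLS]): the TRANSPORT ALGEBRA behind the (1.1) witness for a represented tower — `DependsOn` closure,
# regrouping a cube product by components, and `Factorizes11` from a cube-product χ-part times a factorizing residual

[IV] = [Balaban1989LargeFieldI] (CMP 122:175); [III] = [Balaban1988Convergent] (CMP 119:243).

THE PRINT.  [IV] (1.1) p. 177: *«𝐓_k(Z_k) = 𝐓_k(Z_k ∩ Zᶜ)𝐓_k(Z) = 𝐓_k(Z_k ∩ Zᶜ) ∏_{i=1}^n 𝐓_k(X_i), (1.1) where Z = ⋃_{i=1}^n X_i is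
the decomposition into disjoint components»* — the factorization property (2.19)/(2.22) of [III] p. 257–258; [III] (2.17)–(2.18)
p. 257: the small-field characteristic function `χ_k(Ω_k) = ∏_{□ ⊂ Ω_k} χ({…})` (r11's `B14Eq218Concrete.chi218`, `chi218_apply`:
a product over the cubes `□ ∈ cubesIn (s.Ω k)` of local factors).

HONEST PREMISE.  With the 𝐓-operations carried as residual DATA (DEFINER ₇'s `TexpAOfRecord`), «the (2.18) regrouping satisfies
(1.1)» is NOT a theorem about the residual: (1.1) is a property of the actual operations 𝐓_k.  What is kernel algebra — and is
proved here, for ANY `TowerTerm` — is the TRANSPORT: a piece of the form (cube product of local factors) × (residual), with the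
residual factorizing over the components as a displayed clause of printed shape (2.22) [III], satisfies `Factorizes11`.  The
instance in DEFINER ₇'s letters (`chi218_apply` + the residual's clause + the locality of `ukBox` on `□^{∼4}`) is the append-only
sequel (F4) on their word.

WHAT IS PROVED (theorems only; 0 `sorry`; no `instance`/`notation`).
§1 `dependsOn_mono`, `dependsOn_const`, `dependsOn_mul`, `dependsOn_finset_prod` — closure of `Node00.DependsOn`.
§2 `prod_regroup_by_comp` — a finite product over cubes, regrouped by an assignment `comp : κ → Option t.Comp` of cubes to the
   components of `Z` (`none` = outside `Z`): `∏_{c∈C} φ_c = (∏_{comp c = none} φ_c) · ∏_i ∏_{comp c = some i} φ_c`.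
§3 `factorizes11_of_cubeProduct` — `t.piece = (∏_{c∈C} φ_c) · τ`, `φ_c` depending on `S_c ⊆ X_i`'s variables when `comp c = some i`,
   `τ = τ₀ · ∏_i τ_i` with `τ_i` depending on `X_i`'s variables ⇒ `Factorizes11 t`.
HONEST FRAMING: transport algebra; nothing of Bałaban asserted; count-neutral; NOT continuum ∕ OS ∕ mass-gap ∕ Clay.
-/

noncomputable section

open scoped BigOperators

namespace Literature.MathematicalPhysics.QuantumFieldTheory.Balaban1983to89.Node00

open T4Continuum

variable {P : Params} {G : Type*}

/-! ## §1  `DependsOn` algebra -/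

/-- Monotonicity in the variable set. [cite: Balaban1989LargeFieldI, (1.1) p.177 (bookkeeping)] -/
theorem dependsOn_mono {j : ℕ} {S S' : Set (PBond P j)} (h : S ⊆ S') {f : Density P j G} (hf : DependsOn S f) :
    DependsOn S' f :=
  fun V W hVW => hf V W fun b hb => hVW b (h hb)

/-- Constants depend on nothing. [cite: Balaban1989LargeFieldI, (1.1) p.177 (bookkeeping)] -/
theorem dependsOn_const {j : ℕ} (S : Set (PBond P j)) (c : ℝ) : DependsOn S (fun _ : GaugeField P j G => c) :=
  fun _ _ _ => rfl

/-- Products of two. [cite: Balaban1989LargeFieldI, (1.1) p.177 (bookkeeping)] -/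
theorem dependsOn_mul {j : ℕ} {S : Set (PBond P j)} {f g : Density P j G} (hf : DependsOn S f) (hg : DependsOn S g) :
    DependsOn S (fun V => f V * g V) :=
  fun V W h => by
    show f V * g V = f W * g W
    rw [hf V W h, hg V W h]

/-- Finite products: each factor depending on the variables in `S` ⇒ so does the product. [cite: Balaban1989LargeFieldI, (1.1) p.177 (bookkeeping)] -/
theorem dependsOn_finset_prod {j : ℕ} {κ : Type*} (C : Finset κ) (S : Set (PBond P j)) (φ : κ → Density P j G)
    (h : ∀ c ∈ C, DependsOn S (φ c)) : DependsOn S (fun V => ∏ c ∈ C, φ c V) :=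
  fun V W hVW => Finset.prod_congr rfl fun c hc => h c hc V W hVW

/-! ## §2  Regrouping a cube product by components -/

variable {k : ℕ}

/-- **Regrouping by components**: for a finite cube set `C`, factors `φ_c` and an assignment `comp : κ → Option t.Comp` (the
component of `Z` the cube belongs to; `none` = outside `Z`), `∏_{c∈C} φ_c(V) = (∏_{c∈C, comp c = none} φ_c(V)) ·
∏_i ∏_{c∈C, comp c = some i} φ_c(V)` (product over the term's own `Fintype` field). [cite: Balaban1989LargeFieldI, (1.1) p.177;
Balaban1988Convergent, (2.17)–(2.18) p.257] -/
theorem prod_regroup_by_comp (t : TowerTerm P k G) [DecidableEq t.Comp] {κ : Type*} (C : Finset κ) (φ : κ → Density P k G)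
    (comp : κ → Option t.Comp) (V : GaugeField P k G) :
    ∏ c ∈ C, φ c V =
      (∏ c ∈ C with comp c = none, φ c V) *
        @Finset.prod t.Comp ℝ _ (@Finset.univ t.Comp t.finComp) fun i => ∏ c ∈ C with comp c = some i, φ c V := by
  letI : Fintype t.Comp := t.finComp
  have hfib : ∏ o : Option t.Comp, ∏ c ∈ C with comp c = o, φ c V = ∏ c ∈ C, φ c V :=
    Finset.prod_fiberwise_of_maps_to (fun c _ => Finset.mem_univ (comp c)) (fun c => φ c V)
  rw [← hfib, Fintype.prod_option]

/-! ## §3  `Factorizes11` from a cube-product χ-part times a factorizing residual -/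

/-- **The (1.1) witness, transported.**  If the piece of the term is `(∏_{c∈C} φ_c) · τ` where each cube factor `φ_c` depends
only on the variables in `S_c`, with `S_c ⊆` the variables of the component `X_i` whenever the cube is assigned to `X_i`
(`comp c = some i`), and the residual factorizes as `τ = τ₀ · ∏_i τ_i` with `τ_i` depending only on `X_i`'s variables (the
displayed clause of printed shape (2.22) [III] on the residual 𝐓-data), then the term satisfies `Factorizes11` — with the untouched
factor `f₀ := (∏_{comp c = none} φ_c) · τ₀` and `f_i := (∏_{comp c = some i} φ_c) · τ_i`. [cite: Balaban1989LargeFieldI, (1.1) p.177;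
Balaban1988Convergent, (2.17)–(2.19) p.257, (2.22) p.258] -/
theorem factorizes11_of_cubeProduct (t : TowerTerm P k G) [DecidableEq t.Comp] {κ : Type*} (C : Finset κ) (φ : κ → Density P k G)
    (S : κ → Set (PBond P k)) (comp : κ → Option t.Comp) (τ τ₀ : Density P k G) (τc : t.Comp → Density P k G)
    (hpiece : ∀ V, t.piece V = (∏ c ∈ C, φ c V) * τ V)
    (hφ : ∀ c ∈ C, DependsOn (S c) (φ c)) (hS : ∀ c ∈ C, ∀ i, comp c = some i → S c ⊆ t.compVars i)
    (hτ : ∀ V, τ V = τ₀ V * @Finset.prod t.Comp ℝ _ (@Finset.univ t.Comp t.finComp) fun i => τc i V)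
    (hτc : ∀ i, DependsOn (t.compVars i) (τc i)) : Factorizes11 t := by
  letI : Fintype t.Comp := t.finComp
  refine ⟨fun V => (∏ c ∈ C with comp c = none, φ c V) * τ₀ V,
    fun i V => (∏ c ∈ C with comp c = some i, φ c V) * τc i V, ?_, ?_⟩
  · intro i
    refine dependsOn_mul ?_ (hτc i)
    refine dependsOn_finset_prod _ _ _ fun c hc => ?_
    rw [Finset.mem_filter] at hc
    exact dependsOn_mono (hS c hc.1 i hc.2) (hφ c hc.1)
  · intro V
    rw [hpiece V, hτ V, prod_regroup_by_comp t C φ comp V]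
    have e : (∏ i : t.Comp, (∏ c ∈ C with comp c = some i, φ c V) * τc i V) =
        (∏ i : t.Comp, ∏ c ∈ C with comp c = some i, φ c V) * ∏ i : t.Comp, τc i V := Finset.prod_mul_distrib
    change _ = _ * ∏ i : t.Comp, (∏ c ∈ C with comp c = some i, φ c V) * τc i V
    rw [e]
    change (∏ c ∈ C with comp c = none, φ c V) * (∏ i : t.Comp, ∏ c ∈ C with comp c = some i, φ c V) *
        (τ₀ V * ∏ i : t.Comp, τc i V) = _
    ring

/-! ## §4 (v1.1)  The LOCALISED witness (for `Factorizes11Loc`, the repaired shape — dag-ref-B READ-88) -/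

/-- **The localised (1.1) witness, transported**: as `factorizes11_of_cubeProduct`, plus the two locality inputs dag-ref-B names —
the untouched residual factor `τ₀` depends only on `outVars`, and the cubes assigned to no component (`comp c = none`, the cubes
of `Z_k ∩ Zᶜ`) have their variables inside `outVars` — give `Factorizes11Loc t outVars`. [cite: Balaban1989LargeFieldI, (1.1) p.177;
Balaban1988Convergent, (2.17)–(2.19) p.257, (2.22) p.258] -/
theorem factorizes11Loc_of_cubeProduct (t : TowerTerm P k G) [DecidableEq t.Comp] {κ : Type*} (C : Finset κ)
    (φ : κ → Density P k G) (S : κ → Set (PBond P k)) (comp : κ → Option t.Comp) (outVars : Set (PBond P k))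
    (τ τ₀ : Density P k G) (τc : t.Comp → Density P k G)
    (hpiece : ∀ V, t.piece V = (∏ c ∈ C, φ c V) * τ V)
    (hφ : ∀ c ∈ C, DependsOn (S c) (φ c)) (hS : ∀ c ∈ C, ∀ i, comp c = some i → S c ⊆ t.compVars i)
    (hS₀ : ∀ c ∈ C, comp c = none → S c ⊆ outVars)
    (hτ : ∀ V, τ V = τ₀ V * @Finset.prod t.Comp ℝ _ (@Finset.univ t.Comp t.finComp) fun i => τc i V)
    (hτ₀ : DependsOn outVars τ₀) (hτc : ∀ i, DependsOn (t.compVars i) (τc i)) : Factorizes11Loc t outVars := by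
  letI : Fintype t.Comp := t.finComp
  refine ⟨fun V => (∏ c ∈ C with comp c = none, φ c V) * τ₀ V,
    fun i V => (∏ c ∈ C with comp c = some i, φ c V) * τc i V, ?_, ?_, ?_⟩
  · refine dependsOn_mul ?_ hτ₀
    refine dependsOn_finset_prod _ _ _ fun c hc => ?_
    rw [Finset.mem_filter] at hc
    exact dependsOn_mono (hS₀ c hc.1 hc.2) (hφ c hc.1)
  · intro i
    refine dependsOn_mul ?_ (hτc i)
    refine dependsOn_finset_prod _ _ _ fun c hc => ?_
    rw [Finset.mem_filter] at hc
    exact dependsOn_mono (hS c hc.1 i hc.2) (hφ c hc.1)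
  · intro V
    rw [hpiece V, hτ V, prod_regroup_by_comp t C φ comp V]
    have e : (∏ i : t.Comp, (∏ c ∈ C with comp c = some i, φ c V) * τc i V) =
        (∏ i : t.Comp, ∏ c ∈ C with comp c = some i, φ c V) * ∏ i : t.Comp, τc i V := Finset.prod_mul_distrib
    change _ = _ * ∏ i : t.Comp, (∏ c ∈ C with comp c = some i, φ c V) * τc i V
    rw [e]
    change (∏ c ∈ C with comp c = none, φ c V) * (∏ i : t.Comp, ∏ c ∈ C with comp c = some i, φ c V) *
        (τ₀ V * ∏ i : t.Comp, τc i V) = _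
    ring

end Literature.MathematicalPhysics.QuantumFieldTheory.Balaban1983to89.Node00

end
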